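import Summits.Ventures.CertifiedManyBodySolver.Upper.IntervalReaderAutomaton

/-!
# Ventures/CertifiedManyBodySolver — Upper/IntervalReaderEnclosure.lean: Theorem H1′ END TO END (bytes ⇒ enclosure of the witness's number)
(part 12 of the Theorem-H1′ package; parts 1–11: `IntervalReaderSchur` … `IntervalReaderSourcedBoxEnergy`)

HONEST FRAMING: first certified bounds; not a superconductivity verdict; every number certified or labelled
float.  This file is the composition of parts 2–3 (the error law) with part 7 (what the exact sweep computes).  Its
hypotheses are statements about the reader's COMPUTED environments (bytes) — per-step rounding defects and the
radius recursion the code runs — and its conclusion is about the ACTUAL witness `mpsOpenVar L A l r`; no number is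
certified here and nothing is said about the Hubbard model's spectrum or the thermodynamic limit.

* `automatonSweep_error_le` — THEOREM H1′ for the FINITE sweep in the tree's own vocabulary (Fin-indexed sites,
  no extension beyond the last site): site slices `A k` with Gram constants `κ k` (`Σ_s ‖A k s z‖² ≤ κ k ‖z‖²`),
  automaton site operators `O k b c` with operator constants `M k b c ≥` every absolute row/column sum, an EXACT
  initial family `Y₀` (the boundary), COMPUTED families `Ŷ 0, …, Ŷ L` whose step-`k` defect in `‖·‖₂` is `≤ ρ k c`
  (`‖Ŷ (k+1) c − Σ_b transferOp (A k) (O k b c) (Ŷ k b)‖₂ ≤ ρ k c` — ALL roundings of that step, as the code asserts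
  them), and ANY radii with `‖Ŷ 0 b − Y₀ b‖₂ ≤ r 0 b` and `Σ_b M k b c · κ k · r k b + ρ k c ≤ r (k+1) c` (the code's
  upward-rounded recursion `newr1`).  THEN `‖Ŷ L c − automatonSweep L A O Y₀ c‖₂ ≤ r L c`: the last computed
  environment is within the printed radius of the EXACT swept family of part 7.  (Induction on `L`, peeling site `0`:
  the first step's error `ρ 0 + Σ_b M κ r 0 b ≤ r 1` becomes the next initial error; one `(L1)` transfer bound per step.)
* `automatonSweep_entry_error_le` — hence every ENTRY of the last environment is enclosed (part 1's
  `norm_entry_sub_le_of_norm_sub_le`), and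
* `reader_encloses_matrix_element` — with part 7's sandwich identity: for the witness `ψ = mpsOpenVar L A l r`, the
  operator `W` with kernel `automatonKernel L O σ τ b₀ c` and the rank-one exact boundary `Y₀ = Pi.single b₀ ((star l) ⊗ l′)`,
  the reader's final number `star r ⬝ᵥ (Ŷ L c *ᵥ r′)` satisfies
  `‖star r ⬝ᵥ (Ŷ L c *ᵥ r′) − star (ψ_l) ⬝ᵥ (W *ᵥ ψ_{l′})‖ ≤ (Σ_i ‖r i‖) · (Σ_j ‖r′ j‖) · r L c`
  (for the reader's unit boundary vectors the factor is `1`: the number read IS an entry).  With `O = 1`, `β = Unit`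
  this is the `Nrm` chain and `⟨ψ|ψ⟩`; with parts 8–11 the `⟨ψ|H|ψ⟩` chains of the fmps1 / box / sourced-box classes.

So the sentence «the printed interval contains `⟨ψ|ψ⟩` (resp. `den·⟨ψ|H|ψ⟩`) of the certificate's witness» is a tree
theorem GIVEN the per-step defect bounds — which are the only thing the lineage's self-tests, blind planted suites and
non-author replays still have to vouch for (integer GEMM exactness, correct rounding bookkeeping).
-/

noncomputable section

open Matrix Finset WithLp
open scoped BigOperators ComplexOrder Matrix.Norms.L2Operator

namespace Summit.Ventures.CertifiedManyBodySolver.Upper.IntervalReader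

open Literature.MathematicalPhysics.QuantumLattice

variable {q D : ℕ} {β : Type*} [Fintype β] [DecidableEq β]

/-! ## §X  Theorem H1′ for the finite automaton sweep -/

omit [DecidableEq β] in
/-- **Theorem H1′, finite sweep, tree vocabulary.**  See the module docstring.  The conclusion compares the LAST
computed family with the EXACT swept family `automatonSweep L A O Y₀` of part 7. -/
theorem automatonSweep_error_le : ∀ (L : ℕ) (A : Fin L → MPSTensor q D)
    (O : Fin L → β → β → Matrix (Fin q) (Fin q) ℂ)
    (κ : Fin L → ℝ) (_hκ0 : ∀ k, 0 ≤ κ k)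
    (_hκ : ∀ k (z : EuclideanSpace ℂ (Fin D)), ∑ s, ‖toLp 2 (A k s *ᵥ ofLp z)‖ ^ 2 ≤ κ k * ‖z‖ ^ 2)
    (M : Fin L → β → β → ℝ) (_hM0 : ∀ k b c, 0 ≤ M k b c)
    (_hMrow : ∀ k b c s, ∑ s', ‖O k b c s s'‖ ≤ M k b c) (_hMcol : ∀ k b c s', ∑ s, ‖O k b c s s'‖ ≤ M k b c)
    (Y₀ : β → Matrix (Fin D) (Fin D) ℂ) (Yh : Fin (L + 1) → β → Matrix (Fin D) (Fin D) ℂ)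
    (ρ : Fin L → β → ℝ)
    (_hρ : ∀ (k : Fin L) (c : β),
      ‖Yh k.succ c - ∑ b, transferOp (A k) (O k b c) (Yh k.castSucc b)‖ ≤ ρ k c)
    (r : Fin (L + 1) → β → ℝ) (_hr0 : ∀ b, ‖Yh 0 b - Y₀ b‖ ≤ r 0 b)
    (_hr : ∀ (k : Fin L) (c : β), ∑ b, M k b c * κ k * r k.castSucc b + ρ k c ≤ r k.succ c),
    ∀ c, ‖Yh (Fin.last L) c - automatonSweep L A O Y₀ c‖ ≤ r (Fin.last L) c
  | 0, A, O, κ, hκ0, hκ, M, hM0, hMrow, hMcol, Y₀, Yh, ρ, hρ, r, hr0, hr => by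
    intro c
    rw [automatonSweep_zero]
    exact hr0 c
  | L + 1, A, O, κ, hκ0, hκ, M, hM0, hMrow, hMcol, Y₀, Yh, ρ, hρ, r, hr0, hr => by
    -- the exact family after site `0`
    set Y₁ : β → Matrix (Fin D) (Fin D) ℂ := fun c => ∑ b, transferOp (A 0) (O 0 b c) (Y₀ b) with hY₁
    -- the first step: defect + transported initial error ≤ r 1
    have hstart : ∀ c, ‖Yh 1 c - Y₁ c‖ ≤ r 1 c := by
      intro c
      have hdef := hρ 0 c
      rw [Fin.castSucc_zero] at hdef
      have hsplit : Yh (Fin.succ 0) c - Y₁ c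
          = (Yh (Fin.succ 0) c - ∑ b, transferOp (A 0) (O 0 b c) (Yh 0 b)) +
            ∑ b, transferOp (A 0) (O 0 b c) (Yh 0 b - Y₀ b) := by
        simp only [hY₁, transferOp_sub, Finset.sum_sub_distrib]
        abel
      have h1 : (1 : Fin (L + 2)) = Fin.succ 0 := rfl
      rw [h1, hsplit]
      refine (norm_add_le _ _).trans ?_
      have hL1 : ∀ b, ‖transferOp (A 0) (O 0 b c) (Yh 0 b - Y₀ b)‖ ≤ M 0 b c * κ 0 * r 0 b := by
        intro b
        have h := l2_opNorm_transferOp_le (A 0) (hκ0 0) (hκ 0) (O 0 b c) (hM0 0 b c) (hM0 0 b c)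
          (hMrow 0 b c) (hMcol 0 b c) (Yh 0 b - Y₀ b)
        rw [Real.sqrt_mul_self (hM0 0 b c)] at h
        exact h.trans (mul_le_mul_of_nonneg_left (hr0 b) (mul_nonneg (hM0 0 b c) (hκ0 0)))
      have hsum : ‖∑ b, transferOp (A 0) (O 0 b c) (Yh 0 b - Y₀ b)‖ ≤ ∑ b, M 0 b c * κ 0 * r 0 b :=
        (norm_sum_le _ _).trans (Finset.sum_le_sum fun b _ => hL1 b)
      have hrec := hr 0 c
      rw [Fin.castSucc_zero] at hrec
      linarith [hdef, hsum, hrec]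
    -- induction on the remaining `L` sites with initial family `Y₁` and computed families `Ŷ ∘ succ`
    have ih := automatonSweep_error_le L (fun j => A j.succ) (fun j => O j.succ) (fun j => κ j.succ)
      (fun j => hκ0 j.succ) (fun j => hκ j.succ) (fun j => M j.succ) (fun j => hM0 j.succ)
      (fun j => hMrow j.succ) (fun j => hMcol j.succ) Y₁ (fun k => Yh k.succ) (fun j => ρ j.succ)
      (fun k c => by
        have h := hρ k.succ c
        rwa [← Fin.succ_castSucc] at h)
      (fun k => r k.succ) hstart
      (fun k c => by
        have h := hr k.succ c
        rwa [← Fin.succ_castSucc] at h)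
    intro c
    have h := ih c
    rw [Fin.succ_last] at h
    rw [automatonSweep_succ_apply]
    exact h

omit [DecidableEq β] in
/-- **Every entry of the last environment is enclosed** (part 1's `norm_entry_sub_le_of_norm_sub_le`). -/
theorem automatonSweep_entry_error_le (L : ℕ) (A : Fin L → MPSTensor q D)
    (O : Fin L → β → β → Matrix (Fin q) (Fin q) ℂ)
    (κ : Fin L → ℝ) (hκ0 : ∀ k, 0 ≤ κ k)
    (hκ : ∀ k (z : EuclideanSpace ℂ (Fin D)), ∑ s, ‖toLp 2 (A k s *ᵥ ofLp z)‖ ^ 2 ≤ κ k * ‖z‖ ^ 2)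
    (M : Fin L → β → β → ℝ) (hM0 : ∀ k b c, 0 ≤ M k b c)
    (hMrow : ∀ k b c s, ∑ s', ‖O k b c s s'‖ ≤ M k b c) (hMcol : ∀ k b c s', ∑ s, ‖O k b c s s'‖ ≤ M k b c)
    (Y₀ : β → Matrix (Fin D) (Fin D) ℂ) (Yh : Fin (L + 1) → β → Matrix (Fin D) (Fin D) ℂ)
    (ρ : Fin L → β → ℝ)
    (hρ : ∀ (k : Fin L) (c : β),
      ‖Yh k.succ c - ∑ b, transferOp (A k) (O k b c) (Yh k.castSucc b)‖ ≤ ρ k c)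
    (r : Fin (L + 1) → β → ℝ) (hr0 : ∀ b, ‖Yh 0 b - Y₀ b‖ ≤ r 0 b)
    (hr : ∀ (k : Fin L) (c : β), ∑ b, M k b c * κ k * r k.castSucc b + ρ k c ≤ r k.succ c)
    (c : β) (i j : Fin D) :
    ‖Yh (Fin.last L) c i j - automatonSweep L A O Y₀ c i j‖ ≤ r (Fin.last L) c :=
  norm_entry_sub_le_of_norm_sub_le
    (automatonSweep_error_le L A O κ hκ0 hκ M hM0 hMrow hMcol Y₀ Yh ρ hρ r hr0 hr c) i j

/-! ## §Y  The number read vs the witness's matrix element -/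

/-- A boundary pairing is controlled entrywise: if every entry of `X` has norm `≤ ε` then
`‖star u ⬝ᵥ (X *ᵥ v)‖ ≤ (Σ_i ‖u i‖) · (Σ_j ‖v j‖) · ε`. -/
theorem norm_star_dotProduct_mulVec_le {m n : Type*} [Fintype m] [Fintype n] (u : m → ℂ) (v : n → ℂ)
    (X : Matrix m n ℂ) {ε : ℝ} (hX : ∀ i j, ‖X i j‖ ≤ ε) :
    ‖star u ⬝ᵥ (X *ᵥ v)‖ ≤ (∑ i, ‖u i‖) * (∑ j, ‖v j‖) * ε := by
  calc ‖star u ⬝ᵥ (X *ᵥ v)‖ = ‖∑ i, star (u i) * ∑ j, X i j * v j‖ := by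
        simp only [dotProduct, mulVec, Pi.star_apply]
    _ ≤ ∑ i, ‖star (u i) * ∑ j, X i j * v j‖ := norm_sum_le _ _
    _ ≤ ∑ i, ‖u i‖ * (ε * ∑ j, ‖v j‖) := by
        refine Finset.sum_le_sum fun i _ => ?_
        rw [norm_mul, norm_star]
        refine mul_le_mul_of_nonneg_left ?_ (norm_nonneg _)
        calc ‖∑ j, X i j * v j‖ ≤ ∑ j, ‖X i j * v j‖ := norm_sum_le _ _
          _ ≤ ∑ j, ε * ‖v j‖ := Finset.sum_le_sum fun j _ => by
              rw [norm_mul]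
              exact mul_le_mul_of_nonneg_right (hX i j) (norm_nonneg _)
          _ = ε * ∑ j, ‖v j‖ := by rw [Finset.mul_sum]
    _ = (∑ i, ‖u i‖) * (∑ j, ‖v j‖) * ε := by
        rw [← Finset.sum_mul]
        ring

/-- **The reader encloses the witness's matrix element.**  Hypotheses: the computed families `Ŷ` of an
`L`-site automaton sweep started (within `rad 0`) from the EXACT rank-one boundary family `Pi.single b₀ ((star l) ⊗ l′)`,
with per-step defects `ρ` and a radius recursion `rad` as in `automatonSweep_error_le`.  Conclusion: the number the
reader pairs out of its last environment, `star r ⬝ᵥ (Ŷ L c *ᵥ r′)`, is within `(Σ‖r i‖)(Σ‖r′ j‖) · rad L c` of the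
witness's matrix element `star (mpsOpenVar L A l r) ⬝ᵥ (W *ᵥ mpsOpenVar L A l′ r′)` for the operator `W` the
automaton represents (kernel `automatonKernel L O σ τ b₀ c`; part 7).  For unit boundary vectors the factor is `1`. -/
theorem reader_encloses_matrix_element (L : ℕ) (A : Fin L → MPSTensor q D)
    (O : Fin L → β → β → Matrix (Fin q) (Fin q) ℂ)
    (κ : Fin L → ℝ) (hκ0 : ∀ k, 0 ≤ κ k)
    (hκ : ∀ k (z : EuclideanSpace ℂ (Fin D)), ∑ s, ‖toLp 2 (A k s *ᵥ ofLp z)‖ ^ 2 ≤ κ k * ‖z‖ ^ 2)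
    (M : Fin L → β → β → ℝ) (hM0 : ∀ k b c, 0 ≤ M k b c)
    (hMrow : ∀ k b c s, ∑ s', ‖O k b c s s'‖ ≤ M k b c) (hMcol : ∀ k b c s', ∑ s, ‖O k b c s s'‖ ≤ M k b c)
    (b₀ c : β) (W : Op (Fin L) q) (hW : ∀ σ τ, W σ τ = automatonKernel L O σ τ b₀ c)
    (l l' r r' : Fin D → ℂ) (Yh : Fin (L + 1) → β → Matrix (Fin D) (Fin D) ℂ) (ρ : Fin L → β → ℝ)
    (hρ : ∀ (k : Fin L) (c : β),
      ‖Yh k.succ c - ∑ b, transferOp (A k) (O k b c) (Yh k.castSucc b)‖ ≤ ρ k c)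
    (rad : Fin (L + 1) → β → ℝ)
    (hr0 : ∀ b, ‖Yh 0 b - (Pi.single b₀ (vecMulVec (star l) l') : β → Matrix (Fin D) (Fin D) ℂ) b‖ ≤ rad 0 b)
    (hr : ∀ (k : Fin L) (c : β), ∑ b, M k b c * κ k * rad k.castSucc b + ρ k c ≤ rad k.succ c) :
    ‖star r ⬝ᵥ (Yh (Fin.last L) c *ᵥ r') - star (mpsOpenVar L A l r) ⬝ᵥ (W *ᵥ mpsOpenVar L A l' r')‖ ≤
      (∑ i, ‖r i‖) * (∑ j, ‖r' j‖) * rad (Fin.last L) c := by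
  rw [inner_mulVec_mpsOpenVar_eq_automatonSweep L A O b₀ c W hW l l' r r', ← dotProduct_sub, ← sub_mulVec]
  exact norm_star_dotProduct_mulVec_le r r' _
    (automatonSweep_entry_error_le L A O κ hκ0 hκ M hM0 hMrow hMcol _ Yh ρ hρ rad hr0 hr c)

/-! ## §Z  The one-state case: product operators (the words of parts 6, 8–11) — appended 2026-08-27 -/

/-- Sums over the one-state automaton are single terms. -/
private theorem sum_unit {E : Type*} [AddCommMonoid E] (f : Unit → E) : ∑ b : Unit, f b = f () :=
  Fintype.sum_unique f

/-- With the one-state automaton (`β = Unit`, `O k () () = O k`) the swept family IS part 6's `envSweep`. -/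
theorem automatonSweep_unit : ∀ (L : ℕ) (A : Fin L → MPSTensor q D) (O : Fin L → Matrix (Fin q) (Fin q) ℂ)
    (X : Matrix (Fin D) (Fin D) ℂ),
    automatonSweep L A (fun k (_ _ : Unit) => O k) (fun _ => X) () = envSweep L A O X
  | 0, A, O, X => rfl
  | L + 1, A, O, X => by
    rw [automatonSweep_succ_apply, envSweep_succ]
    have h : (fun _ : Unit => ∑ b : Unit, transferOp (A 0) (O 0) ((fun _ : Unit => X) b)) =
        fun _ : Unit => transferOp (A 0) (O 0) X := by
      funext
      rw [sum_unit]
    rw [h]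
    exact automatonSweep_unit L _ _ _

/-- **Theorem H1′ for the one-state sweep** (product-operator words, the `Nrm` chain): computed environments
`Ŷ 0, …, Ŷ L` with `‖Ŷ (k+1) − transferOp (A k) (O k) (Ŷ k)‖₂ ≤ ρ k`, exact start `X₀` within `r 0`, radii with
`M k · κ k · r k + ρ k ≤ r (k+1)` ⇒ `‖Ŷ L − envSweep L A O X₀‖₂ ≤ r L`. -/
theorem envSweep_error_le (L : ℕ) (A : Fin L → MPSTensor q D) (O : Fin L → Matrix (Fin q) (Fin q) ℂ)
    (κ : Fin L → ℝ) (hκ0 : ∀ k, 0 ≤ κ k)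
    (hκ : ∀ k (z : EuclideanSpace ℂ (Fin D)), ∑ s, ‖toLp 2 (A k s *ᵥ ofLp z)‖ ^ 2 ≤ κ k * ‖z‖ ^ 2)
    (M : Fin L → ℝ) (hM0 : ∀ k, 0 ≤ M k)
    (hMrow : ∀ k s, ∑ s', ‖O k s s'‖ ≤ M k) (hMcol : ∀ k s', ∑ s, ‖O k s s'‖ ≤ M k)
    (X₀ : Matrix (Fin D) (Fin D) ℂ) (Yh : Fin (L + 1) → Matrix (Fin D) (Fin D) ℂ) (ρ : Fin L → ℝ)
    (hρ : ∀ k : Fin L, ‖Yh k.succ - transferOp (A k) (O k) (Yh k.castSucc)‖ ≤ ρ k)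
    (r : Fin (L + 1) → ℝ) (hr0 : ‖Yh 0 - X₀‖ ≤ r 0)
    (hr : ∀ k : Fin L, M k * κ k * r k.castSucc + ρ k ≤ r k.succ) :
    ‖Yh (Fin.last L) - envSweep L A O X₀‖ ≤ r (Fin.last L) := by
  have h := automatonSweep_error_le L A (fun k (_ _ : Unit) => O k) κ hκ0 hκ (fun k _ _ => M k)
    (fun k _ _ => hM0 k) (fun k _ _ => hMrow k) (fun k _ _ => hMcol k) (fun _ => X₀) (fun k _ => Yh k)
    (fun k _ => ρ k) (fun k _ => by rw [sum_unit]; exact hρ k) (fun k _ => r k) (fun _ => hr0)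
    (fun k _ => by rw [sum_unit]; exact hr k) ()
  rwa [automatonSweep_unit] at h

/-- **The reader encloses every product-operator matrix element** (norm, densities, hopping / pairing words of
parts 8–11): for `W` with kernel `Π_k O k (σ k) (τ k)` and computed one-state environments as in `envSweep_error_le`
started from `(star l) ⊗ l′`, the reader's number `star r ⬝ᵥ (Ŷ L *ᵥ r′)` is within `(Σ‖r i‖)(Σ‖r′ j‖) · rad L` of
`star (mpsOpenVar L A l r) ⬝ᵥ (W *ᵥ mpsOpenVar L A l′ r′)`. -/
theorem reader_encloses_productOp_element (L : ℕ) (A : Fin L → MPSTensor q D)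
    (O : Fin L → Matrix (Fin q) (Fin q) ℂ)
    (κ : Fin L → ℝ) (hκ0 : ∀ k, 0 ≤ κ k)
    (hκ : ∀ k (z : EuclideanSpace ℂ (Fin D)), ∑ s, ‖toLp 2 (A k s *ᵥ ofLp z)‖ ^ 2 ≤ κ k * ‖z‖ ^ 2)
    (M : Fin L → ℝ) (hM0 : ∀ k, 0 ≤ M k)
    (hMrow : ∀ k s, ∑ s', ‖O k s s'‖ ≤ M k) (hMcol : ∀ k s', ∑ s, ‖O k s s'‖ ≤ M k)
    (W : Op (Fin L) q) (hW : ∀ σ τ, W σ τ = ∏ k, O k (σ k) (τ k))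
    (l l' r r' : Fin D → ℂ) (Yh : Fin (L + 1) → Matrix (Fin D) (Fin D) ℂ) (ρ : Fin L → ℝ)
    (hρ : ∀ k : Fin L, ‖Yh k.succ - transferOp (A k) (O k) (Yh k.castSucc)‖ ≤ ρ k)
    (rad : Fin (L + 1) → ℝ) (hr0 : ‖Yh 0 - vecMulVec (star l) l'‖ ≤ rad 0)
    (hr : ∀ k : Fin L, M k * κ k * rad k.castSucc + ρ k ≤ rad k.succ) :
    ‖star r ⬝ᵥ (Yh (Fin.last L) *ᵥ r') - star (mpsOpenVar L A l r) ⬝ᵥ (W *ᵥ mpsOpenVar L A l' r')‖ ≤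
      (∑ i, ‖r i‖) * (∑ j, ‖r' j‖) * rad (Fin.last L) := by
  rw [inner_mulVec_mpsOpenVar_eq_envSweep L A O W hW l l' r r', ← dotProduct_sub, ← sub_mulVec]
  exact norm_star_dotProduct_mulVec_le r r' _ fun i j =>
    norm_entry_sub_le_of_norm_sub_le
      (envSweep_error_le L A O κ hκ0 hκ M hM0 hMrow hMcol _ Yh ρ hρ rad hr0 hr) i j

end Summit.Ventures.CertifiedManyBodySolver.Upper.IntervalReader

end
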